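import Literature.NumberTheory.Transcendental.KZLogCalculusProofs

/-!
# Route ValuedFieldSpecialisation — crux `ParametricLifting`: Frullani, regularised linearity

Helper toward crux stmt-KontsevichZagierPeriods-3498 (`ParametricLifting`), line `registered`,
stub `frullani_exists_linearity` of the Frullani calibration (lead c6). In coordinates `z 0 = s`
(the parameter, `0 < s < 1/2`) and `z 1 = t` (the fibre variable), on the band
`V = {(s, t) | 0 < s, 2 s < 1, s ≤ t ≤ 1} = KZlog.band {0 < y 0 ∧ 2 y 0 < 1} (y ↦ y 0) 1`
the partial-fraction identity

  `1 / (t (1 + t)) = 1 / ((1 + t) (1 + 2 t)) + 1 / (t (1 + 2 t))`      (`t > 0`)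

is an instance of Kontsevich–Zagier's additivity in the integrand AMONG FAMILIES: from the family
`A = (V, 1/(t(1+t)))` we construct `R₁ = (V, 1/((1+t)(1+2t)))` and `B = (V, 1/(t(1+2t)))` as
integral representations — rational `ℚ`-semialgebraic integrands, absolutely integrable on `V` by
domination (`0 ≤ 1/((1+t)(1+2t)) ≤ 1/(t(1+t))` and `0 ≤ 1/(t(1+2t)) ≤ 1/(t(1+t))` for `t > 0`)
from the integrability of `A` — and record `[A] − [R₁] − [B] ∈ KZ.integrandAddRel`. At the special
fibre `s = 0` neither `A` nor `B` is integrable on `(0, 1]` (their slice values diverge like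
`log (1/s)`), so this linearity is only legal among the regularised families.

Sources: M. Kontsevich, D. Zagier, *Periods* (2001), §1.2 (rule (1)); G. Boros, V. Moll,
*Irresistible Integrals* (2004), §5.6 (Frullani). No new definitions.
-/

noncomputable section

namespace Summit.KontsevichZagierPeriods.ValuedFieldSpecialisation

open MeasureTheory Set Filter MvPolynomial
open scoped Topology
open Literature.NumberTheory.Transcendental Literature.NumberTheory.Transcendental.KZ
open Literature.ModelTheory.ExponentialFields (IsSemialgebraic isSemialgebraic_setOf_eval_pos
  isSemialgebraic_setOf_eval_lt isSemialgebraic_setOf_eval_le)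

/-- Points of the Frullani band `{(s, t) | 0 < s, 2 s < 1, s ≤ t ≤ 1}` (coordinates `z 0 = s`,
`z 1 = t`): `0 < z 0`, `2 z 0 < 1`, `z 0 ≤ z 1 ≤ 1`. [folklore] -/
theorem frullani_linearity_mem_band {z : Fin (1 + 1) → ℝ}
    (hz : z ∈ KZlog.band {y : Fin 1 → ℝ | 0 < y 0 ∧ 2 * y 0 < 1} (fun y => y 0) (fun _ => 1)) :
    0 < z 0 ∧ 2 * z 0 < 1 ∧ z 0 ≤ z 1 ∧ z 1 ≤ 1 := by
  rw [KZlog.mem_band, mem_setOf_eq] at hz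
  exact ⟨hz.1.1, hz.1.2, hz.2.1, hz.2.2⟩

/-- **Domination on a common domain.** If `f` is the (integrable) integrand of a representation `A`
and `g` is a `ℚ`-semialgebraic function on `A.domain` with `|g| ≤ f` there, then `g` is absolutely
integrable on `A.domain` (`MeasureTheory.Integrable.mono'`). [folklore] -/
theorem frullani_integrableOn_of_abs_le {n : ℕ} (A : KZ.IntegralRep n) {g : (Fin n → ℝ) → ℝ}
    (hg : IsSemialgebraicFunOn ℚ A.domain g) (hle : ∀ z ∈ A.domain, |g z| ≤ A.integrand z) :
    IntegrableOn g A.domain := by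
  have hm : MeasurableSet A.domain := IntegralRep.measurableSet_domain_holds A
  refine Integrable.mono' A.integrableOn (aestronglyMeasurable_of_isSemialgebraicFunOn hg hm) ?_
  filter_upwards [ae_restrict_mem hm] with z hz
  rw [Real.norm_eq_abs]
  exact hle z hz

/-- **Stub B (regularised linearity).** Over the band `{0 < s, 2 s < 1, s ≤ t ≤ 1}`:
`1/(t(1+t)) = 1/((1+t)(1+2t)) + 1/(t(1+2t))` as an instance of integrand additivity among
FAMILIES — given `A = (V, 1/(t(1+t)))`, the representations `R₁ = (V, 1/((1+t)(1+2t)))` and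
`B = (V, 1/(t(1+2t)))` exist (integrable by domination from `A`) and
`[A] − [R₁] − [B] ∈ KZ.integrandAddRel`. [Kontsevich–Zagier 2001, §1.2 rule (1)] [folklore] -/
theorem frullani_exists_linearity :
    ∀ (A : KZ.IntegralRep (1 + 1)), A.domain = KZlog.band {y : Fin 1 → ℝ | 0 < y 0 ∧ 2 * y 0 < 1} (fun y => y 0) (fun _ => 1) → (A.integrand = fun z => (z 1 * (1 + z 1))⁻¹) → ∃ R₁ B : KZ.IntegralRep (1 + 1), R₁.domain = KZlog.band {y : Fin 1 → ℝ | 0 < y 0 ∧ 2 * y 0 < 1} (fun y => y 0) (fun _ => 1) ∧ (R₁.integrand = fun z => ((1 + z 1) * (1 + 2 * z 1))⁻¹) ∧ B.domain = KZlog.band {y : Fin 1 → ℝ | 0 < y 0 ∧ 2 * y 0 < 1} (fun y => y 0) (fun _ => 1) ∧ (B.integrand = fun z => (z 1 * (1 + 2 * z 1))⁻¹) ∧ KZ.of A - KZ.of R₁ - KZ.of B ∈ KZ.integrandAddRel := by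
  intro A hAd hAi
  -- on the band the fibre variable `t = z 1` is positive (`0 < s ≤ t`)
  have hpos : ∀ z ∈ A.domain, 0 < z 1 := fun z hz => by
    rw [hAd] at hz
    obtain ⟨h0, -, h01, -⟩ := frullani_linearity_mem_band hz
    exact h0.trans_le h01
  -- the two new integrands are rational, hence `ℚ`-semialgebraic on the band
  have hgsa : IsSemialgebraicFunOn ℚ A.domain
      (fun z : Fin (1 + 1) → ℝ => ((1 + z 1) * (1 + 2 * z 1))⁻¹) := by
    refine (isSemialgebraicFunOn_aeval_div_aeval A.isSemialgebraic_domain 1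
      ((1 + X 1) * (1 + 2 * X 1)) fun z hz => ?_).congr fun z _ => ?_
    · have ht := hpos z hz
      simp only [map_mul, map_add, map_one, map_ofNat, aeval_X]
      positivity
    · simp
  have hhsa : IsSemialgebraicFunOn ℚ A.domain
      (fun z : Fin (1 + 1) → ℝ => (z 1 * (1 + 2 * z 1))⁻¹) := by
    refine (isSemialgebraicFunOn_aeval_div_aeval A.isSemialgebraic_domain 1
      (X 1 * (1 + 2 * X 1)) fun z hz => ?_).congr fun z _ => ?_
    · have ht := hpos z hz
      simp only [map_mul, map_add, map_one, map_ofNat, aeval_X]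
      positivity
    · simp
  -- and dominated by the integrand of `A`, hence integrable on the band
  have hgint : IntegrableOn (fun z : Fin (1 + 1) → ℝ => ((1 + z 1) * (1 + 2 * z 1))⁻¹) A.domain := by
    refine frullani_integrableOn_of_abs_le A hgsa fun z hz => ?_
    have ht := hpos z hz
    rw [hAi, abs_of_pos (by positivity)]
    exact inv_anti₀ (by positivity) (by nlinarith)
  have hhint : IntegrableOn (fun z : Fin (1 + 1) → ℝ => (z 1 * (1 + 2 * z 1))⁻¹) A.domain := by
    refine frullani_integrableOn_of_abs_le A hhsa fun z hz => ?_
    have ht := hpos z hz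
    rw [hAi, abs_of_pos (by positivity)]
    exact inv_anti₀ (by positivity) (by nlinarith)
  refine ⟨⟨A.domain, fun z => ((1 + z 1) * (1 + 2 * z 1))⁻¹, A.isSemialgebraic_domain, hgsa, hgint⟩,
    ⟨A.domain, fun z => (z 1 * (1 + 2 * z 1))⁻¹, A.isSemialgebraic_domain, hhsa, hhint⟩,
    hAd, rfl, hAd, rfl, ?_⟩
  -- the partial-fraction identity on the band is an integrand-additivity instance
  refine ⟨1 + 1, A,
    ⟨A.domain, fun z => ((1 + z 1) * (1 + 2 * z 1))⁻¹, A.isSemialgebraic_domain, hgsa, hgint⟩,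
    ⟨A.domain, fun z => (z 1 * (1 + 2 * z 1))⁻¹, A.isSemialgebraic_domain, hhsa, hhint⟩,
    rfl, rfl, fun z hz => ?_, rfl⟩
  have ht := hpos z hz
  have h1 : (1 + z 1) ≠ 0 := by positivity
  have h2 : (1 + 2 * z 1) ≠ 0 := by positivity
  simp only [hAi, Pi.add_apply]
  field_simp
  ring

end Summit.KontsevichZagierPeriods.ValuedFieldSpecialisation
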